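import Summits.BirchSwinnertonDyer.BirchSwinnertonDyer.Theorems.SignedLowerHalvesSprungLowerDivisibilityAtThreeIotaQuotientCert
import HarnessLib

/-!
# Crux `SprungLowerDivisibilityAtThree` (K1, item stmt-BirchSwinnertonDyer-19875), line `chromatic-common-zeros`:
# THE DIGITS OF `F(T^ι)` — closed form `[T^e] F(T^ι) = (−1)^e Σ_{1 ≤ d ≤ e} C(e−1, d−1)·F_d` (`e ≥ 1`), `[T^0] = F_0`

Cell `bsd-ssimc` (host), width seat `cruxlead-stmt-BirchSwinnertonDyer-19875-w3` (gen 4); `--supports` 19875 `--as helper`; theorems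
only (pure power-series algebra, any commutative ring); closes NO item. K1, BSD and leaf X8 are NOT proved by anything here.

For the single-colour doors (R12)–(R15-GB) (`…IotaRigiditySelf`, `…IotaSelfCoprime`, `…IotaSelfBezout`) the data engines need the
`3`-adic digits of `L^∘(T^ι)`, `ι = (1+T)⁻¹ − 1`. With `ι = −T·(1+T)⁻¹`:

* `coeff_invOnePlusSubOne_add_one_pow_succ` — `[T^m] (1+ι)^{d+1} = [T^m] (1+T)^{−(d+1)} = (−1)^m·C(m+d, d)`;
* `coeff_invOnePlusSubOne_pow_succ` — `[T^e] (T^ι)^{d+1} = 0` for `e ≤ d`, `= (−1)^e·C(e−1, d)` for `e ≥ d+1`;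
* **`coeff_subst_invOnePlusSubOne_closedForm`** — `[T^0] F(T^ι) = F_0` and, for `e ≥ 1`,
  `[T^e] F(T^ι) = (−1)^e · Σ_{d ∈ [1, e]} C(e−1, d−1)·F_d` (so the matrix of `F ↦ F(T^ι)` on coefficients is the signed
  Pascal matrix, an involution).

References: [GreenbergLNM1716] §1 (the involution); Mathlib `Nat.sum_range_add_choose` (Zhu Shijie / hockey stick).
-/

set_option linter.dupNamespace false
set_option autoImplicit false

noncomputable section

open scoped Classical

open Literature.Barriers.BirchSwinnertonDyer Literature.NumberTheory.EllipticCurves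

namespace Summit.BirchSwinnertonDyer.BirchSwinnertonDyer.Theorems.ChromaticIota

section Digits

variable {R : Type*} [CommRing R]

/-- `[T^m](1 + ι) = (−1)^m` (`1 + ι = (1+T)⁻¹ = Σ (−T)^m`). [cite: GreenbergLNM1716, §1] -/
theorem coeff_invOnePlusSubOne_add_one (m : ℕ) :
    PowerSeries.coeff m ((invOnePlusSubOne : PowerSeries R) + 1) = (-1) ^ m := by
  rw [map_add, coeff_invOnePlusSubOne, PowerSeries.coeff_one]
  rcases Nat.eq_zero_or_pos m with rfl | hm
  · simp
  · rw [if_neg hm.ne', if_neg hm.ne', add_zero]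

/-- **`[T^m] (1+ι)^{d+1} = (−1)^m·C(m+d, d)`** (negative binomial series; induction via the hockey-stick identity).
[cite: GreenbergLNM1716, §1] -/
theorem coeff_invOnePlusSubOne_add_one_pow_succ (d m : ℕ) :
    PowerSeries.coeff m (((invOnePlusSubOne : PowerSeries R) + 1) ^ (d + 1)) = (-1) ^ m * ((m + d).choose d : R) := by
  induction d generalizing m with
  | zero => rw [zero_add, pow_one, coeff_invOnePlusSubOne_add_one, add_zero, Nat.choose_zero_right, Nat.cast_one, mul_one]
  | succ d ih =>
    rw [pow_succ, PowerSeries.coeff_mul, Finset.Nat.sum_antidiagonal_eq_sum_range_succ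
      (fun a b => PowerSeries.coeff a (((invOnePlusSubOne : PowerSeries R) + 1) ^ (d + 1)) *
        PowerSeries.coeff b ((invOnePlusSubOne : PowerSeries R) + 1))]
    have hterm : ∀ a ∈ Finset.range (m + 1),
        PowerSeries.coeff a (((invOnePlusSubOne : PowerSeries R) + 1) ^ (d + 1)) *
          PowerSeries.coeff (m - a) ((invOnePlusSubOne : PowerSeries R) + 1) =
        (-1) ^ m * ((a + d).choose d : R) := by
      intro a ha
      have ha' : a ≤ m := Nat.lt_succ_iff.mp (Finset.mem_range.mp ha)
      rw [ih, coeff_invOnePlusSubOne_add_one]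
      have hpow : ((-1 : R) ^ a) * (-1) ^ (m - a) = (-1) ^ m := by
        rw [← pow_add, Nat.add_sub_cancel' ha']
      linear_combination ((a + d).choose d : R) * hpow
    rw [Finset.sum_congr rfl hterm, ← Finset.mul_sum]
    congr 1
    have h := Nat.sum_range_add_choose m d
    rw [show m + d + 1 = m + (d + 1) by ring] at h
    exact_mod_cast congrArg (Nat.cast (R := R)) h

/-- **`[T^e] (T^ι)^{d+1}`**: `0` for `e ≤ d`, `(−1)^e·C(e−1, d)` for `e ≥ d+1` (`(T^ι)^{d+1} = (−T)^{d+1}(1+ι)^{d+1}`).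
[cite: GreenbergLNM1716, §1] -/
theorem coeff_invOnePlusSubOne_pow_succ (d e : ℕ) :
    PowerSeries.coeff e ((invOnePlusSubOne : PowerSeries R) ^ (d + 1)) =
      if e ≤ d then 0 else (-1) ^ e * ((e - 1).choose d : R) := by
  have hι : (invOnePlusSubOne : PowerSeries R) = -PowerSeries.X * (invOnePlusSubOne + 1) := invOnePlusSubOne_eq_neg_X_mul
  have hpow : (invOnePlusSubOne : PowerSeries R) ^ (d + 1) =
      PowerSeries.C ((-1 : R) ^ (d + 1)) * (PowerSeries.X ^ (d + 1) * (invOnePlusSubOne + 1) ^ (d + 1)) := by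
    conv_lhs => rw [hι]
    rw [mul_pow, neg_pow, map_pow, map_neg, map_one]
    ring
  rw [hpow, PowerSeries.coeff_C_mul, PowerSeries.coeff_X_pow_mul']
  split_ifs with h1 h2 h2
  · omega
  · rw [coeff_invOnePlusSubOne_add_one_pow_succ, ← mul_assoc, ← pow_add]
    have he : d + 1 + (e - (d + 1)) = e := by omega
    have he' : e - (d + 1) + d = e - 1 := by omega
    rw [he, he']
  · rw [mul_zero]
  · omega

/-- **THE DIGITS OF `F(T^ι)` (closed form).** `[T^0] F(T^ι) = F_0`, and for `e ≥ 1`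
`[T^e] F(T^ι) = (−1)^e · Σ_{d=1}^{e} C(e−1, d−1)·F_d` — an INTEGER combination of `F_1, …, F_e`, so `3`-adic digits of `F` give
those of `F(T^ι)` (cf. `pow_dvd_coeff_subst_sub_of_forall`). [cite: GreenbergLNM1716, §1] -/
theorem coeff_subst_invOnePlusSubOne_closedForm {p : ℕ} [Fact p.Prime] (F : IwasawaAlgebra p) (e : ℕ) :
    PowerSeries.coeff e (PowerSeries.subst (invOnePlusSubOne : IwasawaAlgebra p) F) =
      if e = 0 then PowerSeries.constantCoeff F
      else (-1) ^ e * ∑ d ∈ Finset.range e, ((e - 1).choose d : ℤ_[p]) * PowerSeries.coeff (d + 1) F := by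
  rw [coeff_subst_invOnePlusSubOne_eq_sum]
  split_ifs with he
  · subst he
    rw [Finset.sum_range_one, pow_zero, PowerSeries.coeff_one, if_pos rfl, mul_one,
      PowerSeries.coeff_zero_eq_constantCoeff_apply]
  · rw [Finset.sum_range_succ', pow_zero, PowerSeries.coeff_one, if_neg he, mul_zero, add_zero, Finset.mul_sum]
    refine Finset.sum_congr rfl fun d hd => ?_
    have hd' : d < e := Finset.mem_range.mp hd
    rw [coeff_invOnePlusSubOne_pow_succ, if_neg (by omega)]
    ring

end Digits

end Summit.BirchSwinnertonDyer.BirchSwinnertonDyer.Theorems.ChromaticIota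

end
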